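import Mathlib
import Summits.KontsevichZagierPeriods.Zeta5Search.Ray1Windows
import HarnessLib

/-!
# ζ(5) search — RAY #1 of the T1 map (`β = (85; 35,32,30,27,25,22,20)`, `d = 64`): the type-space window `θ ∈ (23/8, 32/11]` (`M = 46`), typed (HONEST FRAMING: systematic search; no irrationality claim unless certified)

Cell `pub-zeta5`, prover seat p3 generation 4 (a separate file rather than a second addendum to `Ray1WindowsDeep.lean`: appending to a statement
module stalls every dependent proposal for one farm rebuild).  The next regular ZERO-regime window of ray 1 below `θ = 3` found by the scale-free
scan `code/winscan.py` (frame `M = 46`, DEG edge `128/44 = 32/11`): ONE deep palindrome of 29 points and ONE extra conjugate pair, validated over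
ALL odd `p` with `n ≤ 300` (760 instances, 0 failures, `code/wintest.py`); width `32/11 − 23/8 = 3/88` (MODEL bookkeeping for the census, one digit).
Format of `Ray1Windows.lean` §2–§3.  `p`-adic bookkeeping of rational numbers; nothing here bears on irrationality.
-/

noncomputable section

open Finset

namespace Summit.KontsevichZagierPeriods.Zeta5Search.T1Rays

open Summit.KontsevichZagierPeriods.Zeta5Search.CasoratianValuation (InPolytope shift casoratian)
open Summit.KontsevichZagierPeriods.Zeta5Search.ZeroWindows (ZeroWindowClasses)

/-- Ray 1, `M = 46` (`θ ∈ (23/8, 32/11]`): the deep palindrome (classes of 29 points). -/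
def Dz46r1 : List (List ℤ) :=
  [[1, 1, 1, 1, 1, 1, 1, -1, -2, -3, -4, -5, -6, -6, -6, -6, -6, -5, -4, -3, -2, -1, 1, 1, 1, 1, 1, 1, 1]]

/-- Ray 1, `M = 46` (`θ ∈ (23/8, 32/11]`): the extra conjugate pair (one member). -/
def Sz46r1 : List (List ℤ) :=
  [[1, 1, 1, 1, 1, 1, 0, -1, -2, -3, -4, -5, -6, -6, -6, -6, -6, -5, -4, -3, -1, 0, 1, 1, 1, 1, 1, 1, 1]]

/-- **RAY-#1 WINDOW `θ ∈ (23/8, 32/11]`** (zero regime, `M = 46`; size hypothesis `85n + 2 < p²` explicit): `v_p(Cas₇(b(n))) ≥ -86 = 6 − 2M` (width `3/88`). -/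
@[conjecture] def Ray1WindowZ32o11 : Prop :=
  ∀ n p : ℕ, 2 ≤ n → p.Prime → 23 * n < 8 * p → 11 * p ≤ 32 * n → 85 * n + 2 < p ^ 2 → casoratian (bRay β1 n) 7 ≠ 0 →
    (-86 : ℤ) ≤ padicValRat p (casoratian (bRay β1 n) 7)

/-- **CLASS STRUCTURE, ray #1, zero window `(23/8, 32/11]`, `M = 46`** (`23 * n < 8 * p`, `11 * p ≤ 32 * n`): deep palindrome `Dz46r1`, extra pair `Sz46r1`;
every odd `p` of the window with `n ≤ 300`, 0 failures (p3 g4 bracket analysis). -/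
@[conjecture] def Ray1ZeroClassesZ32o11 : Prop :=
  ∀ n p : ℕ, 2 ≤ n → p.Prime → 23 * n < 8 * p → 11 * p ≤ 32 * n → 85 * n + 2 < p ^ 2 → ZeroWindowClasses (bRay β1 n) p 46 Dz46r1 Sz46r1

/-- **`Ray1WindowZ32o11` from its class structure** (gen-2 g16's `ray1Zero_of_classes`). -/
theorem ray1WindowZ32o11_of (hC : Ray1ZeroClassesZ32o11) : Ray1WindowZ32o11 := by
  intro n p hn hp h1 h2 hw hne
  exact ray1Zero_of_classes n p 46 Dz46r1 Sz46r1 (by omega) hp (by omega) (by omega) hw (by norm_num) (by decide)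
    (by push_cast; omega) (by decide) (by decide) (hC n p hn hp h1 h2 hw) hne

set_option maxRecDepth 8000 in
/-- Zero window `Z32o11` (`M = 46`), instance `(n, p) = (10, 29)` (the class structure holds there although `85·10 + 2 > 29²`: the size hypothesis is the
valuation law's, not the class structure's). -/
theorem ray1_Z32o11_10_29 : ZeroWindowClasses (bRay β1 10) 29 46 Dz46r1 Sz46r1 := by decide

end Summit.KontsevichZagierPeriods.Zeta5Search.T1Rays

end
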